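import Mathlib
import Literature.Probability.LatticeModels.ProdBernoulliIndependence
import Summits.CriticalPhenomena.PercolationContinuityZ3.Theses.PercNearOneGluing
import Summits.CriticalPhenomena.PercolationContinuityZ3.Theorems.PercNearOneGluingNearOneGluingSmallPockets
import HarnessLib

/-!
# Crux `PercNearOneGluing.NearOneGluing` (stmt-CriticalPhenomena-4574), line `live-seal-vanishing-sprinkle`
# — corollaries of `stub_smallPockets`: logarithmic form, and Conjecture 3 for bounded relay-free regions

Lead prover-line-stmt-CriticalPhenomena-4574-a1-1 (cycle 2).  Lands with `--supports stmt-CriticalPhenomena-4574`.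

Setting: one finite weighted graph (`Fin n`, weights `w`, `μ = prodBernoulli w` on bond configurations
`ω : Set (Sym2 (Fin n))`), relays `A`, source `o`, target `b`; `P ω` = relay-free pocket of `o`
(`v ∈ P ω ↔ o ↔ v` inside `(↑A)ᶜ`); bad `= {o ↮ b} ∩ {o ↔ A}`.

* `smallPockets_log` (registered deliverable): for `0 < t < e⁻¹` bounding the relay unreliabilities,
  `μ{bad ∧ |P ω| = k} ≤ e · k^k · (log(1/t))^{k-1} · t` — the landed `stub_smallPockets`
  (`≤ t^s (1-s)^{-(k-1)} k^k`, p93036) at the optimal exponent `s = 1 - 1/log(1/t)`, where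
  `t^{-1/log(1/t)} = e`.  So pockets of size `k` cost `Õ(t)` as long as `k log k ≲ log(1/t)/log log(1/t)`.
* `nearOneGluing_of_boundedRegion`: Kozma–Nitzan's Conjecture 3 HOLDS, uniformly in `|A|`, over all
  instances in which the source has a relay-free region `R ∋ o` of at most `K` vertices that is joined to
  the other non-relays only by weight-zero pairs (`δ` depends on `ε` and `K` only).  `K = 1` (`R = {o}`,
  "`o` isolated in `G ∖ A`") is the ε–δ shadow of Kozma–Nitzan's Theorem 4 (arXiv:2401.12397 §3.2), and
  `K = 2` covers their Theorem 5; general `K` is new.  Proof: the pocket `P ω` lies inside `R` off the null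
  event that a weight-zero pair is open, so the bad event splits into `|P ω| = k`, `k ≤ K`, each of mass
  `≤ √t · 2^{k-1} k^k` (`stub_smallPockets` at `s = 1/2`), plus `μ(o ↮ A)`.
-/

namespace Summit.CriticalPhenomena.PercolationContinuityZ3.Theorems

open scoped BigOperators Classical
open MeasureTheory Set
open Literature.Probability.LatticeModels (prodBernoulli prodBernoulli_real_setOf_mem)
open Literature.Probability.Percolation (openConn openConnIn)
open Summit.CriticalPhenomena.PercolationContinuityZ3.Theses.PercNearOneGluing (NearOneGluing)

/-- Arithmetic of the optimal exponent: with `L = log(1/t) > 1` and `s = 1 - 1/L` one has `0 < s < 1` and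
`t^s (1-s)^{-(k-1)} k^k = e · k^k · L^{k-1} · t`. -/
theorem smallPockets_log_arith (t : ℝ) (ht0 : 0 < t) (ht1 : t < Real.exp (-1)) (k : ℕ) :
    0 < 1 - 1 / Real.log (1 / t) ∧ 1 - 1 / Real.log (1 / t) < 1 ∧
      t ^ (1 - 1 / Real.log (1 / t)) / (1 - (1 - 1 / Real.log (1 / t))) ^ (k - 1) * (k : ℝ) ^ k =
        Real.exp 1 * (k : ℝ) ^ k * (Real.log (1 / t)) ^ (k - 1) * t := by
  set L := Real.log (1 / t) with hLdef
  set s := 1 - 1 / L with hsdef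
  have hlogt : Real.log t = -L := by simp [hLdef]
  have hL : 1 < L := by
    have : Real.log t < -1 := by
      rw [← Real.exp_lt_exp, Real.exp_log ht0]; exact ht1
    linarith
  have hL0 : 0 < L := by linarith
  refine ⟨?_, ?_, ?_⟩
  · rw [sub_pos, div_lt_one hL0]; exact hL
  · have : 0 < 1 / L := by positivity
    linarith
  · have hs : 1 - s = 1 / L := by simp [hsdef]
    rw [hs]
    have hts : t ^ s = Real.exp 1 * t := by
      rw [Real.rpow_def_of_pos ht0, hlogt]
      have : -L * s = 1 + (-L) := by
        simp only [hsdef]; field_simp; ring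
      rw [this, Real.exp_add, ← hlogt, Real.exp_log ht0]
    rw [hts, one_div, inv_pow, div_inv_eq_mul]
    ring

/-- **Small pockets, logarithmic form** (registered deliverable `smallPockets_log`).  If `o ∉ A`,
`μ(a ↮ b) ≤ t` on `A` with `0 < t < e⁻¹`, then for every `k`:
`μ{o ↮ b ∧ o ↔ A ∧ |P ω| = k} ≤ e · k^k · (log(1/t))^{k-1} · t`.  Corollary of the landed
`stub_smallPockets` at `s = 1 - 1/log(1/t)`. -/
theorem smallPockets_log : ∀ (n : ℕ) (w : Sym2 (Fin n) → unitInterval) (A : Finset (Fin n)) (o b : Fin n), o ∉ A → ∀ (t : ℝ), 0 < t → t < Real.exp (-1) → ∀ (k : ℕ), (∀ a ∈ A, (Literature.Probability.LatticeModels.prodBernoulli w).real (Literature.Probability.Percolation.openConn a b)ᶜ ≤ t) → ∀ (P : Set (Sym2 (Fin n)) → Finset (Fin n)), (∀ ω v, v ∈ P ω ↔ ω ∈ Literature.Probability.Percolation.openConnIn ((↑A : Set (Fin n))ᶜ) o v) → (Literature.Probability.LatticeModels.prodBernoulli w).real {ω | ω ∉ Literature.Probability.Percolation.openConn o b ∧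 (∃ a ∈ A, ω ∈ Literature.Probability.Percolation.openConn o a) ∧ (P ω).card = k} ≤ Real.exp 1 * (k : ℝ) ^ k * (Real.log (1 / t)) ^ (k - 1) * t := by
  intro n w A o b ho t ht0 ht1 k hrel P hP
  obtain ⟨hs0, hs1, heq⟩ := smallPockets_log_arith t ht0 ht1 k
  rw [← heq]
  exact stub_smallPockets n w A o b ho t (1 - 1 / Real.log (1 / t)) ht0.le hs0 hs1 k hrel P hP

/-- **Kozma–Nitzan Conjecture 3 for bounded relay-free regions** (`|A|`-uniform).  For every `K` and
`ε > 0` there is `δ > 0` (depending on `ε, K` only) such that on every finite weighted graph: if `o` lies in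
a set `R` of at most `K` vertices all of whose pairs towards non-relays outside `R` have weight `0`, and
`P(o ↔ A) > 1 - δ`, `P(a ↔ b) > 1 - δ` for all `a ∈ A`, then `P(o ↔ b) > 1 - ε`.  `K = 1` is the ε–δ form
of Kozma–Nitzan's Theorem 4 (arXiv:2401.12397, §3.2: `o` isolated in `G ∖ A`). -/
theorem nearOneGluing_of_boundedRegion : ∀ (K : ℕ) (ε : ℝ), 0 < ε → ∃ δ : ℝ, 0 < δ ∧ ∀ (n : ℕ) (w : Sym2 (Fin n) → unitInterval) (A : Finset (Fin n)) (o b : Fin n) (R : Finset (Fin n)), o ∈ R → R.card ≤ K → (∀ x ∈ R, ∀ y ∉ R, y ∉ A → w s(x, y) = 0) → 1 - δ < (Literature.Probability.LatticeModels.prodBernoulli w).real (⋃ a ∈ A, Literature.Probability.Percolation.openConn o a) → (∀ a ∈ A, 1 - δ < (Literature.Probability.LatticeModels.prodBernoulli w).real (Literature.Probability.Percolation.openConn a b)) → 1 - ε < (Literature.Probability.LatticeModels.prodBernoulli w).real (Literature.Probability.Percolation.openConn o b) := by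
  intro K ε hε
  -- the small-pocket constant at `s = 1/2`
  set D : ℝ := ∑ k ∈ Finset.range (K + 1), 1 / ((1 : ℝ) / 2) ^ (k - 1) * (k : ℝ) ^ k with hD
  have hD0 : 0 ≤ D := Finset.sum_nonneg fun k _ => by positivity
  set c : ℝ := ε / (4 * (D + 1)) with hc
  have hc0 : 0 < c := by positivity
  refine ⟨min (ε / 4) (c ^ 2), by positivity, ?_⟩
  intro n w A o b R hoR hRK hR0 hoA hrel
  set δ : ℝ := min (ε / 4) (c ^ 2) with hδdef
  have hδ1 : δ ≤ ε / 4 := min_le_left _ _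
  have hδ2 : δ ≤ c ^ 2 := min_le_right _ _
  have hδ0 : 0 ≤ δ := by positivity
  set μ := prodBernoulli w with hμ
  have hoA' : μ.real (⋃ a ∈ A, openConn o a)ᶜ ≤ δ := by
    rw [probReal_compl_eq_one_sub MeasurableSet.of_discrete]; linarith
  have hrel' : ∀ a ∈ A, μ.real (openConn a b)ᶜ ≤ δ := by
    intro a ha
    rw [probReal_compl_eq_one_sub MeasurableSet.of_discrete]
    have := hrel a ha; linarith
  suffices hmain : μ.real (openConn o b)ᶜ < ε by
    rw [probReal_compl_eq_one_sub MeasurableSet.of_discrete] at hmain; linarith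
  by_cases ho : o ∈ A
  · have := hrel' o ho; linarith
  -- `o ∉ A`: the pocket selector and the split of the bad event
  set P : Set (Sym2 (Fin n)) → Finset (Fin n) :=
    fun ω => Finset.univ.filter fun v => ω ∈ openConnIn ((↑A : Set (Fin n))ᶜ) o v with hPdef
  have hP : ∀ ω v, v ∈ P ω ↔ ω ∈ openConnIn ((↑A : Set (Fin n))ᶜ) o v := by
    intro ω v; simp [hPdef]
  set Ssmall : ℕ → Set (Set (Sym2 (Fin n))) := fun k =>
    {ω | ω ∉ openConn o b ∧ (∃ a ∈ A, ω ∈ openConn o a) ∧ (P ω).card = k} with hSsmall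
  -- weight-zero pairs from `R` to outside non-relays
  set Z : Finset (Sym2 (Fin n)) := Finset.univ.filter fun e : Sym2 (Fin n) => (w e : ℝ) = 0 with hZ
  set Null : Set (Set (Sym2 (Fin n))) := ⋃ e ∈ Z, {ω | e ∈ ω} with hNull
  have hNull0 : μ.real Null = 0 := by
    refine le_antisymm ?_ measureReal_nonneg
    calc μ.real Null ≤ ∑ e ∈ Z, μ.real {ω | e ∈ ω} := measureReal_biUnion_finset_le _ _
      _ = ∑ e ∈ Z, (0 : ℝ) := by
          refine Finset.sum_congr rfl fun e he => ?_
          rw [hZ, Finset.mem_filter] at he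
          rw [hμ, prodBernoulli_real_setOf_mem]; exact he.2
      _ = 0 := Finset.sum_const_zero
  -- the pocket stays inside `R` unless a weight-zero pair is open
  have hpocket : ∀ ω, ω ∉ Null → P ω ⊆ R := by
    intro ω hω v hv
    by_contra hvR
    have hpath : Literature.Probability.Percolation.PathIn
        (Literature.Probability.Percolation.openGraph ω) ((↑A : Set (Fin n))ᶜ) o v :=
      Literature.Probability.Percolation.DCT16.pathIn_of_mem_openConnIn ((hP ω v).1 hv)
    obtain ⟨x, y, hx, hy, hyA, hxy, -⟩ :=
      hpath.exit (R := (↑R : Set (Fin n))) (Finset.mem_coe.2 hoR) (fun h => hvR (Finset.mem_coe.1 h))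
    rw [Literature.Probability.Percolation.openGraph_adj] at hxy
    have hw0 : (w s(x, y) : ℝ) = 0 := by
      have := hR0 x (Finset.mem_coe.1 hx) y (fun h => hy (Finset.mem_coe.2 h))
        (fun h => hyA (Finset.mem_coe.2 h))
      rw [this]; rfl
    refine hω (mem_iUnion₂.2 ⟨s(x, y), ?_, hxy.1⟩)
    rw [hZ, Finset.mem_filter]
    exact ⟨Finset.mem_univ _, hw0⟩
  have hcover : (openConn o b)ᶜ ⊆
      (⋃ a ∈ A, openConn o a)ᶜ ∪ ((⋃ k ∈ Finset.range (K + 1), Ssmall k) ∪ Null) := by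
    intro ω hω
    by_cases hU : ω ∈ ⋃ a ∈ A, openConn o a
    · right
      by_cases hN : ω ∈ Null
      · right; exact hN
      · left
        have hA : ∃ a ∈ A, ω ∈ openConn o a := by
          simpa only [mem_iUnion, exists_prop] using hU
        have hk : (P ω).card ≤ K := (Finset.card_le_card (hpocket ω hN)).trans hRK
        exact mem_iUnion₂.2 ⟨(P ω).card, Finset.mem_range.2 (Nat.lt_succ_of_le hk), hω, hA, rfl⟩
    · left; exact hU
  have h1 : μ.real (⋃ k ∈ Finset.range (K + 1), Ssmall k) ≤ δ ^ ((1 : ℝ) / 2) * D := by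
    calc μ.real (⋃ k ∈ Finset.range (K + 1), Ssmall k)
        ≤ ∑ k ∈ Finset.range (K + 1), μ.real (Ssmall k) := measureReal_biUnion_finset_le _ _
      _ ≤ ∑ k ∈ Finset.range (K + 1), δ ^ ((1 : ℝ) / 2) / (1 - 1 / 2) ^ (k - 1) * (k : ℝ) ^ k := by
          refine Finset.sum_le_sum fun k _ => ?_
          exact stub_smallPockets n w A o b ho δ (1 / 2) hδ0 (by norm_num) (by norm_num) k hrel' P hP
      _ = δ ^ ((1 : ℝ) / 2) * D := by
          rw [hD, Finset.mul_sum]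
          refine Finset.sum_congr rfl fun k _ => ?_
          norm_num
          ring
  have hsqrt : δ ^ ((1 : ℝ) / 2) ≤ c := by
    have : δ ^ ((1 : ℝ) / 2) ≤ (c ^ 2) ^ ((1 : ℝ) / 2) := Real.rpow_le_rpow hδ0 hδ2 (by norm_num)
    refine this.trans_eq ?_
    rw [← Real.sqrt_eq_rpow, Real.sqrt_sq hc0.le]
  have h1' : δ ^ ((1 : ℝ) / 2) * D ≤ ε / 4 := by
    calc δ ^ ((1 : ℝ) / 2) * D ≤ c * D := mul_le_mul_of_nonneg_right hsqrt hD0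
      _ = ε / 4 * (D / (D + 1)) := by rw [hc]; field_simp
      _ ≤ ε / 4 * 1 := by
          refine mul_le_mul_of_nonneg_left ?_ (by positivity)
          rw [div_le_one (by positivity)]; linarith
      _ = ε / 4 := mul_one _
  calc μ.real (openConn o b)ᶜ
      ≤ μ.real ((⋃ a ∈ A, openConn o a)ᶜ ∪ ((⋃ k ∈ Finset.range (K + 1), Ssmall k) ∪ Null)) :=
        measureReal_mono hcover (measure_ne_top _ _)
    _ ≤ μ.real (⋃ a ∈ A, openConn o a)ᶜ + (μ.real (⋃ k ∈ Finset.range (K + 1), Ssmall k) +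
          μ.real Null) := by
        refine (measureReal_union_le _ _).trans ?_
        gcongr
        exact measureReal_union_le _ _
    _ ≤ δ + (ε / 4 + 0) := by gcongr <;> linarith
    _ < ε := by linarith

end Summit.CriticalPhenomena.PercolationContinuityZ3.Theorems
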